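import Literature.NumberTheory.EllipticCurves.KleinJCuspExpansion
import HarnessLib

/-!
# Klein's invariant near the cusp to SECOND order on the WIDER disc `‖q‖ ≤ 1/400`:
# `‖j(τ) − 1/q − 744 − 196884·q‖ ≤ 3.3·10⁷·‖q‖²`

certified instances and evidence bearing on the general Hodge conjecture; no claim.

Topic `NumberTheory/EllipticCurves` (level-one modular forms); theorem-only file (no definition, no named fact;
D-0026), everything **proved**.  This is `KleinJCuspExpansionSecondOrder.lean` (‖q‖ ≤ 1/800, constant 3·10⁷) re-run
VERBATIM at the doubled radius `1/400`: the same architecture (`E₄_eq_tsum`, `summable_sigma_mul_qParam_pow`,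
`sigma_three_le_sixteen_pow`, `summable_log_one_sub_pow`, `cexp_tsum_log_one_sub_pow` of `KleinJCuspExpansion.lean` BY NAME,
Mathlib's `Complex.norm_log_sub_logTaylor_le` at order 2 and `Complex.exp_bound` at order 3), with every `r`-dependent
exact-rational side condition re-derived at `r = ‖q‖ ≤ 1/400` (constants OURS):

* `…ModularForms.norm_E₄_sub_sub_sub_le_second_wide` : `‖E₄(τ) − 1 − 240q − 2160q²‖ ≤ 1.03·10⁶‖q‖³` (`(1 − 16r)⁻¹ ≤ 1.042`);
* `…ModularForms.norm_E₄_cube_sub_sub_sub_le_second_wide` : `‖E₄(τ)³ − 1 − 720q − 179280q²‖ ≤ 2.61·10⁷‖q‖³`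
  (`‖v‖ ≤ 4740r²`, `‖u + 240q‖ ≤ 492r`, `‖u‖ ≤ 252r`);
* `…ModularForms.norm_tsum_log_one_sub_pow_add_add_le_second_wide` : `‖Σ_{n≥1} log(1 − qⁿ) + q + (3/2)q²‖ ≤ 2‖q‖³` (total `1.339`);
* `…ModularForms.norm_inv_tprod_sub_sub_sub_le_second_wide` : `‖(∏(1 − qⁿ)²⁴)⁻¹ − 1 − 24q − 324q²‖ ≤ 4100‖q‖³` (total `4027.3`);
* `…ModularForms.norm_E₄_cube_div_discriminant_sub_sub_sub_le_second_wide` :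
  **`‖E₄³/Δ − 1/q − 744 − 196884q‖ ≤ 3.3·10⁷‖q‖²`** for `‖q‖ ≤ 1/400`
  (`30640100 + 687438720r + 9191448000r² + 107010000000r³ = 32417815.4` at `r = 1/400`).

WHY 1/400 (lit/TARGETS T23 addendum): the open class-number-two row `D = −91` of the cell's table has its second CM point
`τ_{(5,3,5)} = (−3 + i√91)/10` ON the unit circle, `‖q‖ = e^{−π√91/5} = 1/400.93`, outside every cusp lemma in the tree
(widest `1/800`); there `196884|q| = 491.1`, `21493760|q|² = 133.7`, so only a SECOND-order estimate pins `j(τ_{(5,3,5)}) ≈ 371.24`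
to the `±450` that the level-7 `D`-sign certificate tolerates (this lemma gives `±205`).
PRINTED: the `q`-expansions `E₄ = 1 + 240 Σ σ₃(n)qⁿ`, `Δ = q ∏ (1 − qⁿ)²⁴`, `j = 1/q + 744 + 196884q + 21493760q² + ⋯`
(Cox, Thm. 11.8 and §13.B; Serre VII §4).  OURS: the explicit error constants.  LIMITS: theorem-only Literature lemma; it does
not by itself compute any class polynomial; nothing about HC.

## References

* D. A. Cox, *Primes of the form x² + ny²*, 2nd ed., Wiley 2013, §11.A Thm. 11.8 (`j = 1/q + 744 + 196884q + ⋯`,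
  PDF p. 235), §13.B (`g₂`, `Δ`, `j` expansions, PDF p. 297). [Cox2013]
* J.-P. Serre, *A Course in Arithmetic*, GTM 7, Springer 1973, VII §3.3 and §4. [Serre1973]
-/

noncomputable section

open Complex Filter Topology ArithmeticFunction
open UpperHalfPlane hiding I
open scoped Real

namespace Literature.NumberTheory.EllipticCurves.ModularForms

/-- **`E₄` near the cusp to second order**: for `‖q‖ ≤ 1/400`, `‖E₄(τ) − 1 − 240q − 2160q²‖ ≤ 1030000‖q‖³`
(the tail `240 Σ_{n ≥ 3} σ₃(n)qⁿ` with `σ₃(n) ≤ 16ⁿ`: `240·16³·(1 − 16r)⁻¹ ≤ 240·4096·1.042`; constant ours).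
[cite: Cox2013, §13.B (`g₂(τ) = (2π)⁴/12 · (1 + 240 Σ σ₃(n) qⁿ)`, PDF p. 297)] -/
theorem norm_E₄_sub_sub_sub_le_second_wide (τ : ℍ) (hq : ‖Function.Periodic.qParam 1 (τ : ℂ)‖ ≤ 1 / 400) :
    ‖ModularForm.E₄ τ - 1 - 240 * Function.Periodic.qParam 1 (τ : ℂ) - 2160 * Function.Periodic.qParam 1 (τ : ℂ) ^ 2‖ ≤
      1030000 * ‖Function.Periodic.qParam 1 (τ : ℂ)‖ ^ 3 := by
  set q := Function.Periodic.qParam 1 (τ : ℂ) with hqdef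
  set r := ‖q‖ with hr
  have hr0 : 0 ≤ r := norm_nonneg _
  have hr1 : r ≤ 1 / 400 := hq
  have hs := summable_sigma_mul_qParam_pow τ
  have hs1 : Summable fun n : ℕ ↦ (sigma 3 (n + 1) : ℂ) * q ^ (n + 1) :=
    (summable_nat_add_iff (f := fun n : ℕ ↦ (sigma 3 n : ℂ) * q ^ n) 1).mpr hs
  have hs2 : Summable fun n : ℕ ↦ (sigma 3 (n + 2) : ℂ) * q ^ (n + 2) :=
    (summable_nat_add_iff (f := fun n : ℕ ↦ (sigma 3 n : ℂ) * q ^ n) 2).mpr hs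
  have hs3 : Summable fun n : ℕ ↦ (sigma 3 (n + 3) : ℂ) * q ^ (n + 3) :=
    (summable_nat_add_iff (f := fun n : ℕ ↦ (sigma 3 n : ℂ) * q ^ n) 3).mpr hs
  -- split off the first two terms `σ₃(1) q = q`, `σ₃(2) q² = 9 q²`
  have hσ2 : (sigma 3 2 : ℂ) = 9 := by
    rw [show (2 : ℕ) = 2 ^ 1 by norm_num, sigma_apply_prime_pow Nat.prime_two]
    norm_num [Finset.sum_range_succ]
  have hsplit : ∑' n : ℕ, (sigma 3 (n + 1) : ℂ) * q ^ (n + 1) =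
      q + 9 * q ^ 2 + ∑' n : ℕ, (sigma 3 (n + 3) : ℂ) * q ^ (n + 3) := by
    rw [hs1.tsum_eq_zero_add, hs2.tsum_eq_zero_add]
    simp only [zero_add, sigma_one, Nat.cast_one, one_mul, pow_one, hσ2]
    ring
  have hE : ModularForm.E₄ τ - 1 - 240 * q - 2160 * q ^ 2 = 240 * ∑' n : ℕ, (sigma 3 (n + 3) : ℂ) * q ^ (n + 3) := by
    rw [E₄_eq_tsum, ← hqdef, hsplit]; ring
  -- the tail is bounded by the geometric series `Σ (16 r)^{n+3}`
  have h16 : 16 * r < 1 := by nlinarith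
  have hgeom : HasSum (fun n : ℕ ↦ (16 * r) ^ 3 * (16 * r) ^ n) ((16 * r) ^ 3 * (1 - 16 * r)⁻¹) :=
    (hasSum_geometric_of_lt_one (by positivity) h16).mul_left _
  have htail : ‖∑' n : ℕ, (sigma 3 (n + 3) : ℂ) * q ^ (n + 3)‖ ≤ (16 * r) ^ 3 * (1 - 16 * r)⁻¹ := by
    refine tsum_of_norm_bounded hgeom fun n ↦ ?_
    rw [norm_mul, norm_pow, Complex.norm_natCast, ← hr,
      show (16 * r) ^ 3 * (16 * r) ^ n = 16 ^ (n + 3) * r ^ (n + 3) by ring]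
    exact mul_le_mul_of_nonneg_right (sigma_three_le_sixteen_pow (n + 3)) (pow_nonneg hr0 _)
  rw [hE, norm_mul, show ‖(240 : ℂ)‖ = 240 by norm_num]
  have hinv : (1 - 16 * r)⁻¹ ≤ 1042 / 1000 := by
    rw [inv_le_comm₀ (by linarith) (by norm_num)]
    nlinarith
  calc 240 * ‖∑' n : ℕ, (sigma 3 (n + 3) : ℂ) * q ^ (n + 3)‖
      ≤ 240 * ((16 * r) ^ 3 * (1 - 16 * r)⁻¹) := by gcongr
    _ ≤ 240 * ((16 * r) ^ 3 * (1042 / 1000)) := by gcongr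
    _ ≤ 1030000 * r ^ 3 := by nlinarith [pow_nonneg hr0 3]

/-- **`E₄³` near the cusp to second order**: for `‖q‖ ≤ 1/400`, `‖E₄(τ)³ − 1 − 720q − 179280q²‖ ≤ 2.61·10⁷‖q‖³`
(`E₄ = 1 + u`, `u = 240q + v`, `v = 2160q² + ε`: `E₄³ − 1 − 720q − 179280q² = 3ε + 3v(u + 240q) + u³`,
`‖v‖ ≤ 4740r²`, `‖u + 240q‖ ≤ 492r`, `‖u‖ ≤ 252r`; `3·1030000 + 3·4740·492 + 252³ = 26089248`; constant ours).
[cite: Cox2013, §13.B (`g₂`, `Δ` and `j` expansions, PDF p. 297)] -/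
theorem norm_E₄_cube_sub_sub_sub_le_second_wide (τ : ℍ) (hq : ‖Function.Periodic.qParam 1 (τ : ℂ)‖ ≤ 1 / 400) :
    ‖ModularForm.E₄ τ ^ 3 - 1 - 720 * Function.Periodic.qParam 1 (τ : ℂ) - 179280 * Function.Periodic.qParam 1 (τ : ℂ) ^ 2‖ ≤
      26100000 * ‖Function.Periodic.qParam 1 (τ : ℂ)‖ ^ 3 := by
  set q := Function.Periodic.qParam 1 (τ : ℂ) with hqdef
  set r := ‖q‖ with hr
  have hr0 : 0 ≤ r := norm_nonneg _
  have hr1 : r ≤ 1 / 400 := hq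
  set ε := ModularForm.E₄ τ - 1 - 240 * q - 2160 * q ^ 2 with hεdef
  set u := ModularForm.E₄ τ - 1 with hudef
  set v := u - 240 * q with hvdef
  set w := u + 240 * q with hwdef
  have hε : ‖ε‖ ≤ 1030000 * r ^ 3 := norm_E₄_sub_sub_sub_le_second_wide τ hq
  have hq2 : ‖q ^ 2‖ = r ^ 2 := by rw [norm_pow, hr]
  have hv : ‖v‖ ≤ 4740 * r ^ 2 := by
    have h1 : v = 2160 * q ^ 2 + ε := by simp only [hεdef, hvdef, hudef]; ring
    calc ‖v‖ = ‖2160 * q ^ 2 + ε‖ := by rw [h1]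
      _ ≤ ‖(2160 : ℂ) * q ^ 2‖ + ‖ε‖ := norm_add_le _ _
      _ = 2160 * r ^ 2 + ‖ε‖ := by rw [norm_mul, hq2]; norm_num
      _ ≤ 2160 * r ^ 2 + 1030000 * r ^ 3 := by linarith
      _ ≤ 4740 * r ^ 2 := by nlinarith [pow_nonneg hr0 2]
  have hw : ‖w‖ ≤ 492 * r := by
    have h1 : w = 480 * q + v := by simp only [hwdef, hvdef]; ring
    calc ‖w‖ = ‖480 * q + v‖ := by rw [h1]
      _ ≤ ‖(480 : ℂ) * q‖ + ‖v‖ := norm_add_le _ _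
      _ = 480 * r + ‖v‖ := by rw [norm_mul, hr]; norm_num
      _ ≤ 480 * r + 4740 * r ^ 2 := by linarith
      _ ≤ 492 * r := by nlinarith
  have hu : ‖u‖ ≤ 252 * r := by
    have h1 : u = 240 * q + v := by simp only [hvdef]; ring
    calc ‖u‖ = ‖240 * q + v‖ := by rw [h1]
      _ ≤ ‖(240 : ℂ) * q‖ + ‖v‖ := norm_add_le _ _
      _ = 240 * r + ‖v‖ := by rw [norm_mul, hr]; norm_num
      _ ≤ 240 * r + 4740 * r ^ 2 := by linarith
      _ ≤ 252 * r := by nlinarith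
  have hid : ModularForm.E₄ τ ^ 3 - 1 - 720 * q - 179280 * q ^ 2 = 3 * ε + 3 * (v * w) + u ^ 3 := by
    simp only [hεdef, hudef, hvdef, hwdef]; ring
  rw [hid]
  have hu0 : 0 ≤ ‖u‖ := norm_nonneg _
  have hu3 : ‖u‖ ^ 3 ≤ (252 * r) ^ 3 := by gcongr
  have hvw : ‖v * w‖ ≤ 4740 * r ^ 2 * (492 * r) := by
    rw [norm_mul]; exact mul_le_mul hv hw (norm_nonneg _) (by positivity)
  calc ‖3 * ε + 3 * (v * w) + u ^ 3‖ ≤ ‖3 * ε‖ + ‖3 * (v * w)‖ + ‖u ^ 3‖ := norm_add₃_le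
    _ = 3 * ‖ε‖ + 3 * ‖v * w‖ + ‖u‖ ^ 3 := by simp [norm_pow]
    _ ≤ 3 * (1030000 * r ^ 3) + 3 * (4740 * r ^ 2 * (492 * r)) + (252 * r) ^ 3 := by
        gcongr
    _ ≤ 26100000 * r ^ 3 := by nlinarith [pow_nonneg hr0 3]

/-! ### The Euler product `∏ (1 − qⁿ)` near `q = 0` to second order, `‖q‖ ≤ 1/400` -/

/-- `logTaylor 3 z = z − z²/2` (the quadratic Taylor polynomial of `log(1 + z)`). [folklore] -/
private theorem logTaylor_three (z : ℂ) : Complex.logTaylor 3 z = z - z ^ 2 / 2 := by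
  simp [Complex.logTaylor_succ, Complex.logTaylor_zero]
  ring

/-- **Second-order expansion of `log ∏ (1 − qⁿ)`**: for `‖q‖ ≤ 1/400`,
`‖Σ_{n ≥ 1} log(1 − qⁿ) + q + (3/2)q²‖ ≤ 2‖q‖³` (`log(1 − q) = −q − q²/2 + O(q³)`, `log(1 − q²) = −q² + O(q⁴)`,
`Σ_{n≥3} log(1 − qⁿ) = −q³ + O(q⁴)`; constants ours).
[cite: Cox2013, §13.B (`Δ(τ) = (2π)¹² q ∏ (1 − qⁿ)²⁴`, PDF p. 297)] -/
theorem norm_tsum_log_one_sub_pow_add_add_le_second_wide {q : ℂ} (hq : ‖q‖ ≤ 1 / 400) :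
    ‖∑' n : ℕ, Complex.log (1 - q ^ (n + 1)) + q + 3 / 2 * q ^ 2‖ ≤ 2 * ‖q‖ ^ 3 := by
  set r := ‖q‖ with hr
  have hr0 : 0 ≤ r := norm_nonneg _
  have hr1 : r ≤ 1 / 400 := hq
  have hq1 : ‖q‖ < 1 := by rw [← hr]; linarith
  -- the pieces
  set a : ℕ → ℂ := fun n ↦ Complex.log (1 - q ^ (n + 1)) + q ^ (n + 1) with ha
  have hg : Summable fun n : ℕ ↦ q ^ n := summable_geometric_of_norm_lt_one hq1
  have hg1 : Summable fun n : ℕ ↦ q ^ (n + 1) := (summable_nat_add_iff (f := fun n ↦ q ^ n) 1).mpr hg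
  have hg3 : Summable fun n : ℕ ↦ q ^ (n + 3) := (summable_nat_add_iff (f := fun n ↦ q ^ n) 3).mpr hg
  have hsa : Summable a := (summable_log_one_sub_pow hq1).add hg1
  have hsa1 : Summable fun n : ℕ ↦ a (n + 1) := (summable_nat_add_iff (f := a) 1).mpr hsa
  have hdecomp : ∑' n : ℕ, Complex.log (1 - q ^ (n + 1)) + q + 3 / 2 * q ^ 2 =
      (a 0 + q ^ 2 / 2) + ∑' n, a (n + 1) - ∑' n : ℕ, q ^ (n + 3) := by
    have h1 : ∑' n : ℕ, Complex.log (1 - q ^ (n + 1)) = ∑' n, a n - ∑' n : ℕ, q ^ (n + 1) := by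
      rw [← hsa.tsum_sub hg1]
      exact tsum_congr fun n ↦ by simp [ha]
    have h2 : ∑' n : ℕ, q ^ (n + 1) = q + q ^ 2 + ∑' n : ℕ, q ^ (n + 3) := by
      rw [hg1.tsum_eq_zero_add, ((summable_nat_add_iff (f := fun n ↦ q ^ n) 2).mpr hg).tsum_eq_zero_add]
      simp only [zero_add, pow_one]
      ring_nf
    have h3 : ∑' n, a n = a 0 + ∑' n, a (n + 1) := hsa.tsum_eq_zero_add
    rw [h1, h2, h3]; ring
  -- (i) the n = 0 term to second order: `‖log(1 − q) + q + q²/2‖ ≤ r³ (1 − r)⁻¹ / 3`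
  have hqn : ‖-q‖ < 1 := by rwa [norm_neg]
  have h0 : ‖a 0 + q ^ 2 / 2‖ ≤ r ^ 3 * (1 - r)⁻¹ / 3 := by
    have h := Complex.norm_log_sub_logTaylor_le 2 hqn
    rw [logTaylor_three, norm_neg, ← hr] at h
    have e : a 0 + q ^ 2 / 2 = Complex.log (1 + -q) - (-q - (-q) ^ 2 / 2) := by
      simp only [ha, zero_add, pow_one, sub_eq_add_neg]; ring
    rw [e]
    refine h.trans ?_
    norm_num
  -- (ii) the terms n ≥ 1: `‖log(1 − qⁿ⁺²) + qⁿ⁺²‖ ≤ (rⁿ⁺²)² (1 − rⁿ⁺²)⁻¹/2 ≤ 0.5007·r⁴·(r²)ⁿ`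
  have hr2 : r ^ 2 < 1 := by nlinarith
  have hc : (1 - r)⁻¹ / 2 ≤ 5013 / 10000 := by
    rw [div_le_iff₀ (by norm_num : (0:ℝ) < 2), inv_le_comm₀ (by linarith) (by norm_num)]
    linarith
  have hgeomA : HasSum (fun n : ℕ ↦ (5013 / 10000 * r ^ 4) * (r ^ 2) ^ n)
      ((5013 / 10000 * r ^ 4) * (1 - r ^ 2)⁻¹) :=
    (hasSum_geometric_of_lt_one (by positivity) hr2).mul_left _
  have hA : ‖∑' n, a (n + 1)‖ ≤ (5013 / 10000 * r ^ 4) * (1 - r ^ 2)⁻¹ := by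
    refine tsum_of_norm_bounded hgeomA fun n ↦ ?_
    have hqn2 : ‖-q ^ (n + 2)‖ < 1 := by
      rw [norm_neg, norm_pow]
      exact pow_lt_one₀ hr0 hq1 (Nat.succ_ne_zero _)
    have h1 := Complex.norm_log_one_add_sub_self_le hqn2
    have h2 : a (n + 1) = Complex.log (1 + -q ^ (n + 2)) - -q ^ (n + 2) := by
      simp only [ha, sub_eq_add_neg, neg_neg]
    rw [h2]
    refine h1.trans ?_
    rw [norm_neg, norm_pow, ← hr]
    have hrn : r ^ (n + 2) ≤ r := by
      calc r ^ (n + 2) ≤ r ^ 1 := pow_le_pow_of_le_one hr0 (by linarith) (by omega)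
        _ = r := pow_one r
    have hrn0 : 0 ≤ r ^ (n + 2) := pow_nonneg hr0 _
    have hinv : (1 - r ^ (n + 2))⁻¹ ≤ (1 - r)⁻¹ := by
      gcongr
    calc (r ^ (n + 2)) ^ 2 * (1 - r ^ (n + 2))⁻¹ / 2
        ≤ (r ^ (n + 2)) ^ 2 * (1 - r)⁻¹ / 2 := by gcongr
      _ = ((1 - r)⁻¹ / 2) * (r ^ 4 * (r ^ 2) ^ n) := by ring
      _ ≤ 5013 / 10000 * (r ^ 4 * (r ^ 2) ^ n) := by gcongr
      _ = 5013 / 10000 * r ^ 4 * (r ^ 2) ^ n := by ring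
  -- (iii) `Σ_{n ≥ 3} qⁿ`
  have hgeomB : HasSum (fun n : ℕ ↦ r ^ 3 * r ^ n) (r ^ 3 * (1 - r)⁻¹) :=
    (hasSum_geometric_of_lt_one hr0 hq1).mul_left _
  have hB : ‖∑' n : ℕ, q ^ (n + 3)‖ ≤ r ^ 3 * (1 - r)⁻¹ := by
    refine tsum_of_norm_bounded hgeomB fun n ↦ ?_
    rw [norm_pow, ← hr, pow_add, mul_comm]
  have hinv1 : (1 - r)⁻¹ ≤ 1003 / 1000 := by
    rw [inv_le_comm₀ (by linarith) (by norm_num)]; linarith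
  have hinv2 : (1 - r ^ 2)⁻¹ ≤ 1003 / 1000 := by
    rw [inv_le_comm₀ (by linarith) (by norm_num)]; nlinarith
  have hr3 : 0 ≤ r ^ 3 := pow_nonneg hr0 3
  have hr4 : r ^ 4 ≤ 1 / 400 * r ^ 3 := by nlinarith
  rw [hdecomp]
  calc ‖a 0 + q ^ 2 / 2 + ∑' n, a (n + 1) - ∑' n : ℕ, q ^ (n + 3)‖
      ≤ ‖a 0 + q ^ 2 / 2 + ∑' n, a (n + 1)‖ + ‖∑' n : ℕ, q ^ (n + 3)‖ := norm_sub_le _ _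
    _ ≤ ‖a 0 + q ^ 2 / 2‖ + ‖∑' n, a (n + 1)‖ + ‖∑' n : ℕ, q ^ (n + 3)‖ := by gcongr; exact norm_add_le _ _
    _ ≤ r ^ 3 * (1 - r)⁻¹ / 3 + (5013 / 10000 * r ^ 4) * (1 - r ^ 2)⁻¹ + r ^ 3 * (1 - r)⁻¹ := by gcongr
    _ ≤ r ^ 3 * (1003 / 1000) / 3 + (5013 / 10000 * r ^ 4) * (1003 / 1000) + r ^ 3 * (1003 / 1000) := by gcongr
    _ ≤ 2 * r ^ 3 := by nlinarith

/-- **The reciprocal Euler product near `q = 0` to second order**: for `‖q‖ ≤ 1/400`,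
`‖(∏ (1 − qⁿ⁺¹)²⁴)⁻¹ − 1 − 24q − 324q²‖ ≤ 4100‖q‖³` (`x = −24 Σ log(1 − qⁿ) = 24q + 36q² + δ`, `‖δ‖ ≤ 48r³`,
`e^x − 1 − 24q − 324q² = (e^x − 1 − x − x²/2) + δ + (x − 24q)(x + 24q)/2`, Mathlib's `Complex.exp_bound` at order 3;
`(2/9)·24.1³ + 48 + 36.12·48.1/2 = 4027.3`; constant ours).
[cite: Cox2013, §13.B (`Δ(τ) = (2π)¹² q ∏ (1 − qⁿ)²⁴`, PDF p. 297)] -/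
theorem norm_inv_tprod_sub_sub_sub_le_second_wide {q : ℂ} (hq : ‖q‖ ≤ 1 / 400) :
    ‖(∏' n : ℕ, (1 - q ^ (n + 1)) ^ 24)⁻¹ - 1 - 24 * q - 324 * q ^ 2‖ ≤ 4100 * ‖q‖ ^ 3 := by
  set r := ‖q‖ with hr
  have hr0 : 0 ≤ r := norm_nonneg _
  have hr1 : r ≤ 1 / 400 := hq
  have hq1 : ‖q‖ < 1 := by rw [← hr]; linarith
  set L := ∑' n : ℕ, Complex.log (1 - q ^ (n + 1)) with hL
  have hprod : ∏' n : ℕ, (1 - q ^ (n + 1)) ^ 24 = cexp (24 * L) := by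
    rw [(ModularForm.multipliable_one_sub_pow hq1).tprod_pow, ← cexp_tsum_log_one_sub_pow hq1,
      ← Complex.exp_nat_mul]
    norm_num [hL]
  rw [hprod, ← Complex.exp_neg]
  set δ := -24 * (L + q + 3 / 2 * q ^ 2) with hδ
  have hLq : ‖L + q + 3 / 2 * q ^ 2‖ ≤ 2 * r ^ 3 := norm_tsum_log_one_sub_pow_add_add_le_second_wide hq
  have hδn : ‖δ‖ ≤ 48 * r ^ 3 := by
    rw [hδ, norm_mul, show ‖(-24 : ℂ)‖ = 24 by norm_num]; linarith
  set x := -(24 * L) with hx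
  have hxe : x = 24 * q + 36 * q ^ 2 + δ := by simp only [hx, hδ]; ring
  have hq2 : ‖q ^ 2‖ = r ^ 2 := by rw [norm_pow, hr]
  have hr3 : 0 ≤ r ^ 3 := pow_nonneg hr0 3
  have hxm : ‖x - 24 * q‖ ≤ 3612 / 100 * r ^ 2 := by
    rw [show x - 24 * q = 36 * q ^ 2 + δ by rw [hxe]; ring]
    calc ‖36 * q ^ 2 + δ‖ ≤ ‖(36 : ℂ) * q ^ 2‖ + ‖δ‖ := norm_add_le _ _
      _ = 36 * r ^ 2 + ‖δ‖ := by rw [norm_mul, hq2]; norm_num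
      _ ≤ 36 * r ^ 2 + 48 * r ^ 3 := by linarith
      _ ≤ 3612 / 100 * r ^ 2 := by nlinarith
  have hxp : ‖x + 24 * q‖ ≤ 4810 / 100 * r := by
    rw [show x + 24 * q = 48 * q + (x - 24 * q) by ring]
    calc ‖48 * q + (x - 24 * q)‖ ≤ ‖(48 : ℂ) * q‖ + ‖x - 24 * q‖ := norm_add_le _ _
      _ = 48 * r + ‖x - 24 * q‖ := by rw [norm_mul, hr]; norm_num
      _ ≤ 48 * r + 3612 / 100 * r ^ 2 := by linarith
      _ ≤ 4810 / 100 * r := by nlinarith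
  have hxn : ‖x‖ ≤ 2410 / 100 * r := by
    rw [show x = 24 * q + (x - 24 * q) by ring]
    calc ‖24 * q + (x - 24 * q)‖ ≤ ‖(24 : ℂ) * q‖ + ‖x - 24 * q‖ := norm_add_le _ _
      _ = 24 * r + ‖x - 24 * q‖ := by rw [norm_mul, hr]; norm_num
      _ ≤ 24 * r + 3612 / 100 * r ^ 2 := by linarith
      _ ≤ 2410 / 100 * r := by nlinarith
  have hx1 : ‖x‖ ≤ 1 := by linarith [hxn]
  -- Mathlib: `‖exp x − Σ_{m<3} x^m/m!‖ ≤ ‖x‖³ · (4 / (3! · 3))`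
  have hexp := Complex.exp_bound hx1 (n := 3) (by norm_num)
  have hsum : ∑ m ∈ Finset.range 3, x ^ m / (m.factorial : ℂ) = 1 + x + x ^ 2 / 2 := by
    simp [Finset.sum_range_succ, Nat.factorial]
  rw [hsum] at hexp
  norm_num [Nat.factorial] at hexp
  have hid : cexp x - 1 - 24 * q - 324 * q ^ 2 = (cexp x - (1 + x + x ^ 2 / 2)) + δ + (x - 24 * q) * (x + 24 * q) / 2 := by
    rw [hxe]; ring
  rw [hid]
  have hxx : ‖(x - 24 * q) * (x + 24 * q) / 2‖ ≤ 3612 / 100 * r ^ 2 * (4810 / 100 * r) / 2 := by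
    rw [norm_div, norm_mul, show ‖(2 : ℂ)‖ = 2 by norm_num]
    gcongr ?_ / 2
    exact mul_le_mul hxm hxp (norm_nonneg _) (by positivity)
  have hx3 : ‖x‖ ^ 3 ≤ (2410 / 100 * r) ^ 3 := by gcongr
  calc ‖cexp x - (1 + x + x ^ 2 / 2) + δ + (x - 24 * q) * (x + 24 * q) / 2‖
      ≤ ‖cexp x - (1 + x + x ^ 2 / 2)‖ + ‖δ‖ + ‖(x - 24 * q) * (x + 24 * q) / 2‖ := norm_add₃_le
    _ ≤ ‖x‖ ^ 3 * (2 / 9) + 48 * r ^ 3 + 3612 / 100 * r ^ 2 * (4810 / 100 * r) / 2 := by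
        gcongr
    _ ≤ (2410 / 100 * r) ^ 3 * (2 / 9) + 48 * r ^ 3 + 3612 / 100 * r ^ 2 * (4810 / 100 * r) / 2 := by gcongr
    _ ≤ 4100 * r ^ 3 := by nlinarith

/-! ### Klein's `j` near the cusp to second order, `‖q‖ ≤ 1/400` -/

/-- **Klein's invariant near the cusp to SECOND order: `j = 1/q + 744 + 196884q + O(q²)` with an explicit constant.**
For `τ ∈ ℍ` with `‖q‖ ≤ 1/400` (`q = e^{2πiτ}`), `‖E₄(τ)³/Δ(τ) − 1/q − 744 − 196884q‖ ≤ 3.3·10⁷‖q‖²` (the true next term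
being `21493760q²`; constant ours).  From `E₄³ = 1 + 720q + 179280q² + O(q³)` and `1/∏(1 − qⁿ)²⁴ = 1 + 24q + 324q² + O(q³)`
(`324 + 720·24 + 179280 = 196884`). [cite: Cox2013, §11.A Thm. 11.8 (`j(τ) = 1/q + 744 + 196884q + ⋯`, PDF p. 235)] -/
theorem norm_E₄_cube_div_discriminant_sub_sub_sub_le_second_wide (τ : ℍ)
    (hq : ‖Function.Periodic.qParam 1 (τ : ℂ)‖ ≤ 1 / 400) :
    ‖ModularForm.E₄ τ ^ 3 / ModularForm.discriminant τ - (Function.Periodic.qParam 1 (τ : ℂ))⁻¹ - 744 -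
        196884 * Function.Periodic.qParam 1 (τ : ℂ)‖ ≤ 33000000 * ‖Function.Periodic.qParam 1 (τ : ℂ)‖ ^ 2 := by
  set q := Function.Periodic.qParam 1 (τ : ℂ) with hqdef
  set r := ‖q‖ with hr
  have hr0 : 0 < r := norm_pos_iff.mpr (Function.Periodic.qParam_ne_zero (τ : ℂ))
  have hr1 : r ≤ 1 / 400 := hq
  have hq0 : q ≠ 0 := Function.Periodic.qParam_ne_zero (τ : ℂ)
  set P := ∏' n : ℕ, (1 - q ^ (n + 1)) ^ 24 with hP
  set a := ModularForm.E₄ τ ^ 3 with ha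
  set ε₂ := a - 1 - 720 * q - 179280 * q ^ 2 with hε₂
  set ε₃ := P⁻¹ - 1 - 24 * q - 324 * q ^ 2 with hε₃
  have h₂ : ‖ε₂‖ ≤ 26100000 * r ^ 3 := norm_E₄_cube_sub_sub_sub_le_second_wide τ hq
  have h₃ : ‖ε₃‖ ≤ 4100 * r ^ 3 := norm_inv_tprod_sub_sub_sub_le_second_wide hq
  have hΔ : ModularForm.discriminant τ = q * P := ModularForm.discriminant_eq_q_prod τ
  have hP0 : P ≠ 0 := by
    intro h0
    exact ModularForm.discriminant_ne_zero τ (by rw [hΔ, h0, mul_zero])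
  have hid : a / ModularForm.discriminant τ - q⁻¹ - 744 - 196884 * q =
      (4536000 * q ^ 3 + 58086720 * q ^ 4 + ε₂ * P⁻¹ + ε₃ * (1 + 720 * q + 179280 * q ^ 2)) / q := by
    rw [hΔ]
    simp only [hε₂, hε₃]
    field_simp
    ring
  rw [hid, norm_div, ← hr, div_le_iff₀ hr0]
  have hq2 : ‖q ^ 2‖ = r ^ 2 := by rw [norm_pow, hr]
  have hb : ‖P⁻¹‖ ≤ 1 + 24 * r + 324 * r ^ 2 + 4100 * r ^ 3 := by
    have : P⁻¹ = 1 + 24 * q + 324 * q ^ 2 + ε₃ := by simp only [hε₃]; ring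
    rw [this]
    calc ‖1 + 24 * q + 324 * q ^ 2 + ε₃‖ ≤ ‖(1 : ℂ) + 24 * q + 324 * q ^ 2‖ + ‖ε₃‖ := norm_add_le _ _
      _ ≤ ‖(1 : ℂ) + 24 * q‖ + ‖(324 : ℂ) * q ^ 2‖ + ‖ε₃‖ := by gcongr; exact norm_add_le _ _
      _ ≤ ‖(1 : ℂ)‖ + ‖(24 : ℂ) * q‖ + ‖(324 : ℂ) * q ^ 2‖ + ‖ε₃‖ := by gcongr; exact norm_add_le _ _
      _ = 1 + 24 * r + 324 * r ^ 2 + ‖ε₃‖ := by rw [norm_mul, norm_mul, hq2, hr]; norm_num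
      _ ≤ 1 + 24 * r + 324 * r ^ 2 + 4100 * r ^ 3 := by linarith
  have hc : ‖(1 : ℂ) + 720 * q + 179280 * q ^ 2‖ ≤ 1 + 720 * r + 179280 * r ^ 2 := by
    calc ‖(1 : ℂ) + 720 * q + 179280 * q ^ 2‖ ≤ ‖(1 : ℂ) + 720 * q‖ + ‖(179280 : ℂ) * q ^ 2‖ := norm_add_le _ _
      _ ≤ ‖(1 : ℂ)‖ + ‖(720 : ℂ) * q‖ + ‖(179280 : ℂ) * q ^ 2‖ := by gcongr; exact norm_add_le _ _
      _ = 1 + 720 * r + 179280 * r ^ 2 := by rw [norm_mul, norm_mul, hq2, hr]; norm_num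
  have hr2 : 0 ≤ r ^ 2 := by positivity
  have hr3 : 0 ≤ r ^ 3 := by positivity
  calc ‖4536000 * q ^ 3 + 58086720 * q ^ 4 + ε₂ * P⁻¹ + ε₃ * (1 + 720 * q + 179280 * q ^ 2)‖
      ≤ ‖(4536000 : ℂ) * q ^ 3 + 58086720 * q ^ 4 + ε₂ * P⁻¹‖ + ‖ε₃ * (1 + 720 * q + 179280 * q ^ 2)‖ := norm_add_le _ _
    _ ≤ ‖(4536000 : ℂ) * q ^ 3‖ + ‖(58086720 : ℂ) * q ^ 4‖ + ‖ε₂ * P⁻¹‖ + ‖ε₃ * (1 + 720 * q + 179280 * q ^ 2)‖ := by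
        gcongr; exact norm_add₃_le
    _ = 4536000 * r ^ 3 + 58086720 * r ^ 4 + ‖ε₂‖ * ‖P⁻¹‖ + ‖ε₃‖ * ‖(1 : ℂ) + 720 * q + 179280 * q ^ 2‖ := by
        rw [norm_mul, norm_mul, norm_mul, norm_mul, norm_pow, norm_pow, hr]; norm_num
    _ ≤ 4536000 * r ^ 3 + 58086720 * r ^ 4 + 26100000 * r ^ 3 * (1 + 24 * r + 324 * r ^ 2 + 4100 * r ^ 3) +
          4100 * r ^ 3 * (1 + 720 * r + 179280 * r ^ 2) := by
        gcongr
    _ = (30640100 + 687438720 * r + 9191448000 * r ^ 2 + 107010000000 * r ^ 3) * r ^ 2 * r := by ring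
    _ ≤ 33000000 * r ^ 2 * r := by
        have h1 : 30640100 + 687438720 * r + 9191448000 * r ^ 2 + 107010000000 * r ^ 3 ≤ 33000000 := by nlinarith
        have h2 : 0 ≤ r ^ 2 * r := by positivity
        nlinarith

end Literature.NumberTheory.EllipticCurves.ModularForms

end
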